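import Summits.BirchSwinnertonDyer.BirchSwinnertonDyer.Theorems.PlecticLegsArtinBaseChangePointwise
import Literature.NumberTheory.EllipticCurves.ModularityVersionApProofs

/-!
# `ArtinBaseChange` (route `PlecticLegs`, stmt-BirchSwinnertonDyer-18261): the Dirichlet
# coefficients of `L(E_F, s)`, `F = ℚ(ζ_m)^H`, away from `m`, and the terms at `p ≡ 1 (mod m)`

First of two files disposing UNCONDITIONALLY of the no-continuation (junk) branch of the tree's
`(E_F).analyticRank` for the base change `E_F` of an elliptic `E / ℚ` to an abelian field
`F = ℚ(ζ_m)^H` (the `F`-side of the support item `ArtinBaseChange`; the `ℚ`-side is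
`Literature.NumberTheory.EllipticCurves.BSDRootNumberNoContinuationProofs`). This file extracts
coefficients from the proved Artin formalism:

* `intCoe_LFunction_baseChange_fixedField_apply_of_coprime`: for `n` coprime to `m` the Dirichlet
  coefficient `cₙ(E_F)` is the coefficient of `∏_{χ ∈ Y_H} ∑ χ(n) aₙ(E) n⁻ˢ` — in
  `L(E_F) · ∏_{v ∣ m} ∏_{w ∣ v} L_w(E_F, N w^{-s}) = ∏_{χ ∈ Y_H} χ • L(E)`
  (`intCoe_LFunction_baseChange_mul_eq_prod_twist`) the stripped Euler factors above `m` are `1` at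
  `1` and supported on the integers all of whose prime factors divide `m`
  (`mul_apply_of_coprime`, `ofPowerSeries_apply_eq_zero_of_coprime`,
  `not_coprime_residueCard_of_under_eq`);
* at a prime `p ≡ 1 (mod m)` (so `χ(p) = 1` for every `χ` mod `m`): `c_p(E_F) = d · a_p(E)`
  (`prod_twist_apply_prime`, `d = #Y_H = [F : ℚ]`) and, if moreover `p ∤ N_E` and `a_p(E) = 0`,
  `c_{p²}(E_F) = -d · p` (`prod_twist_apply_prime_sq`, from `a_{p²} = a_p² - p`,
  Diamond–Shurman (8.44), `WeierstrassCurve.LFunction_apply_prime_pow_add_two_of_prime`);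
* hence `p^{-σ} ≤ |c_p(E_F)| p^{-σ} + |c_{p²}(E_F)| (p²)^{-σ}` for `σ ≤ 1` at every such prime
  (`rpow_neg_le_norm_apply_prime_add`): the two terms of `∑ |cₙ(E_F)| n^{-σ}` at `n = p, p²`
  dominate `p^{-σ}`. The divergence of `∑_{p ≡ 1 (m)}` of these and its consequences for
  `(E_F).analyticRank` are in `PlecticLegsArtinBaseChangeNoContinuation`.
-/

noncomputable section

-- D-0017: single-problem summit, so `Summit.BirchSwinnertonDyer.BirchSwinnertonDyer.…` repeats a
-- namespace BY DESIGN.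
set_option linter.dupNamespace false

open scoped Classical
open Complex Filter Topology NumberField ArithmeticFunction IsDedekindDomain WeierstrassCurve
  Polynomial IsCyclotomicExtension.Rat

namespace Summit.BirchSwinnertonDyer.BirchSwinnertonDyer.Theorems

/-! ## Arithmetic functions: coefficients of finite products at `p²`; `m`-supported factors -/

section ArithmeticFunctionLemmas

variable {ι R : Type*} [CommSemiring R]

/-- A finite product of arithmetic functions normalised by `F i 1 = 1` and all vanishing at the
prime `p`, evaluated at `p²`, is the sum of the values `F i (p²)` (the factorisations `p · p`
contribute nothing). [folklore] -/
theorem finsetProd_apply_prime_sq_of_apply_prime_eq_zero (s : Finset ι)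
    (F : ι → ArithmeticFunction R) (h1 : ∀ i, F i 1 = 1) {p : ℕ} (hp : p.Prime)
    (hp0 : ∀ i, F i p = 0) : (∏ i ∈ s, F i) (p ^ 2) = ∑ i ∈ s, F i (p ^ 2) := by
  classical
  have hp2 : p ^ 2 ≠ 1 := fun h ↦ by
    rcases pow_eq_one_iff.mp h with h | h
    · exact hp.ne_one h
    · exact two_ne_zero h
  induction s using Finset.induction_on with
  | empty => simp [one_apply_ne hp2]
  | insert j s hj ih =>
    rw [Finset.prod_insert hj, Finset.sum_insert hj, mul_apply,
      Nat.sum_divisorsAntidiagonal fun a b ↦ F j a * (∏ i ∈ s, F i) b,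
      Nat.sum_divisors_prime_pow hp, Finset.sum_range_succ, Finset.sum_range_succ,
      Finset.sum_range_one]
    simp only [pow_zero, Nat.div_one, h1, one_mul, pow_one, hp0, zero_mul, add_zero,
      Nat.div_self (pow_pos hp.pos 2), finsetProd_apply_one, Finset.prod_const_one, mul_one, ih]
    rw [add_comm]

variable (m : ℕ)

/-- Closure under Dirichlet convolution of "normalised and supported on the integers all of whose
prime factors divide `m`" (spelled: value `1` at `1`, value `0` at every `n ≠ 1` coprime to `m`).
[folklore] -/
theorem mul_apply_eq_zero_of_coprime {f g : ArithmeticFunction R}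
    (hf : f 1 = 1 ∧ ∀ n, n ≠ 1 → n.Coprime m → f n = 0)
    (hg : g 1 = 1 ∧ ∀ n, n ≠ 1 → n.Coprime m → g n = 0) :
    (f * g) 1 = 1 ∧ ∀ n, n ≠ 1 → n.Coprime m → (f * g) n = 0 := by
  refine ⟨by rw [mul_apply_one, hf.1, hg.1, mul_one], fun n hn hnm ↦ ?_⟩
  rw [mul_apply]
  refine Finset.sum_eq_zero fun x hx ↦ ?_
  obtain ⟨hxn, -⟩ := Nat.mem_divisorsAntidiagonal.mp hx
  by_cases hx1 : x.1 = 1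
  · have hx2 : x.2 = n := by rw [← hxn, hx1, one_mul]
    rw [hg.2 x.2 (hx2 ▸ hn) (hx2 ▸ hnm), mul_zero]
  · rw [hf.2 x.1 hx1 (Nat.Coprime.coprime_dvd_left ⟨x.2, hxn.symm⟩ hnm), zero_mul]

/-- `P(q^{-s})` for a power series `P` with constant term `1` and a base `q > 1` sharing a prime
factor with `m` is normalised and vanishes at every `n ≠ 1` coprime to `m` (it is supported on the
powers of `q`). [folklore] -/
theorem ofPowerSeries_apply_eq_zero_of_coprime {q : ℕ} (hq : 1 < q) (hqm : ¬ q.Coprime m)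
    (φ : PowerSeries R) (hφ : φ.constantCoeff = 1) :
    ofPowerSeries q φ 1 = 1 ∧ ∀ n, n ≠ 1 → n.Coprime m → ofPowerSeries q φ n = 0 := by
  refine ⟨by rw [ofPowerSeries_apply_one, hφ], fun n hn hnm ↦ ?_⟩
  rw [ofPowerSeries_apply hq, Function.extend_apply', Pi.zero_apply]
  rintro ⟨k, rfl⟩
  rcases Nat.eq_zero_or_pos k with rfl | hk
  · exact hn (pow_zero q)
  · exact hqm (Nat.Coprime.coprime_dvd_left (dvd_pow_self q hk.ne') hnm)

/-- If `B` is normalised and vanishes off the `m`-supported integers, then `(A * B)(n) = A(n)` at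
every `n` coprime to `m`. [folklore] -/
theorem mul_apply_of_coprime (A : ArithmeticFunction R) {B : ArithmeticFunction R}
    (hB : B 1 = 1 ∧ ∀ n, n ≠ 1 → n.Coprime m → B n = 0) {n : ℕ} (hnm : n.Coprime m) :
    (A * B) n = A n := by
  rcases Nat.eq_zero_or_pos n with rfl | hn
  · simp
  rw [mul_apply, Finset.sum_eq_single (n, 1)]
  · rw [hB.1, mul_one]
  · intro x hx hxn
    obtain ⟨hxn', -⟩ := Nat.mem_divisorsAntidiagonal.mp hx
    have hx2 : x.2 ≠ 1 := by
      rintro h2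
      apply hxn
      rw [h2, mul_one] at hxn'
      exact Prod.ext hxn' h2
    rw [hB.2 x.2 hx2 (Nat.Coprime.coprime_dvd_left ⟨x.1, by rw [mul_comm]; exact hxn'.symm⟩ hnm),
      mul_zero]
  · intro h
    exact absurd (Nat.mem_divisorsAntidiagonal.mpr ⟨mul_one n, hn.ne'⟩) h

end ArithmeticFunctionLemmas

/-! ## The Dirichlet coefficients of `L(E_F, s)` away from `m` -/

section Coefficients

variable (W : WeierstrassCurve ℚ) [W.IsElliptic] (m : ℕ) [NeZero m] (K : Type) [Field K]
  [NumberField K] [IsCyclotomicExtension {m} ℚ K] [IsGalois ℚ K] [IsMulCommutative Gal(K/ℚ)]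
  (H : Subgroup Gal(K/ℚ))

omit [NeZero m] [IsCyclotomicExtension {m} ℚ K] [IsGalois ℚ K] [IsMulCommutative Gal(K/ℚ)] in
/-- A finite place `w` of `F = ℚ(ζ_m)^H` above a place `v ∣ m` of `ℚ` has residue cardinality
`N w` NOT coprime to `m` (both `N w` and `m` lie in the prime ideal `w`). [folklore] -/
theorem not_coprime_residueCard_of_under_eq {v : HeightOneSpectrum (𝓞 ℚ)}
    (hv : (m : 𝓞 ℚ) ∈ v.asIdeal)
    {w : HeightOneSpectrum (𝓞 ↥(IntermediateField.fixedField H))}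
    (hw : w.under (𝓞 ℚ) = v) : ¬ w.residueCard.Coprime m := by
  intro hc
  have hmw : ((m : ℕ) : 𝓞 ↥(IntermediateField.fixedField H)) ∈ w.asIdeal := by
    have h : (m : 𝓞 ℚ) ∈ (w.under (𝓞 ℚ)).asIdeal := by rw [hw]; exact hv
    have h' : algebraMap (𝓞 ℚ) (𝓞 ↥(IntermediateField.fixedField H)) (m : 𝓞 ℚ) ∈ w.asIdeal := h
    rwa [map_natCast] at h'
  have hNw : ((w.residueCard : ℕ) : 𝓞 ↥(IntermediateField.fixedField H)) ∈ w.asIdeal := by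
    exact_mod_cast Ideal.absNorm_mem w.asIdeal
  obtain ⟨a, b, hab⟩ := hc.isCoprime
  apply w.isPrime.ne_top
  rw [Ideal.eq_top_iff_one]
  have h1 : ((1 : ℤ) : 𝓞 ↥(IntermediateField.fixedField H)) ∈ w.asIdeal := by
    rw [← hab]
    push_cast
    exact w.asIdeal.add_mem (w.asIdeal.mul_mem_left _ hNw) (w.asIdeal.mul_mem_left _ hmw)
  exact_mod_cast h1

set_option backward.isDefEq.respectTransparency false in
/-- **The coefficients of `L(E_F, s)` away from `m` are those of `∏_{χ ∈ Y_H} ∑ χ(n) aₙ(E) n⁻ˢ`.**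
For `F = ℚ(ζ_m)^H` with character group `Y_H` and `n` coprime to `m`,
`c_n(E_F) = (∏_{χ ∈ Y_H} χ • L(E))(n)`: in the proved Artin formalism
`L(E_F) · ∏_{v ∣ m} ∏_{w ∣ v} L_w(E_F, N w^{-s}) = ∏_{χ ∈ Y_H} χ • L(E)`
(`intCoe_LFunction_baseChange_mul_eq_prod_twist`) the second factor is `1` at `1` and vanishes at
every other integer coprime to `m`. [folklore] -/
theorem intCoe_LFunction_baseChange_fixedField_apply_of_coprime {n : ℕ} (hn : n.Coprime m) :
    (((W.baseChange ↥(IntermediateField.fixedField H)).LFunction : ArithmeticFunction ℤ) :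
        ArithmeticFunction ℂ) n =
      (∏ χ ∈ Finset.univ.filter (fun χ : DirichletCharacter ℂ m ↦
          χ ∈ (subgroupGalEquivSubgroupChar m K ℂ H).ofDual),
        (toArithmeticFunction (fun k : ℕ ↦ χ (k : ZMod m))).pmul
          ((W.LFunction : ArithmeticFunction ℤ) : ArithmeticFunction ℂ)) n := by
  set F := IntermediateField.fixedField H with hFdef
  have key := intCoe_LFunction_baseChange_mul_eq_prod_twist W m K H
  rw [← key]
  refine (mul_apply_of_coprime m _ ?_ hn).symm
  -- the stripped Euler factors above `m`: normalised, supported on the `m`-supported integers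
  refine Finset.prod_induction _ (fun B : ArithmeticFunction ℂ ↦
      B 1 = 1 ∧ ∀ n, n ≠ 1 → n.Coprime m → B n = 0)
    (fun f g hf hg ↦ mul_apply_eq_zero_of_coprime m hf hg)
    ⟨one_apply, fun n hn _ ↦ one_apply_ne hn⟩ fun v hv ↦ ?_
  rw [Set.Finite.mem_toFinset, Set.mem_setOf_eq] at hv
  -- over `ℤ` first
  suffices h : (∏ᶠ w ∈ {w : HeightOneSpectrum (𝓞 ↥F) | w.under (𝓞 ℚ) = v},
      ofPowerSeries w.residueCard (((W.baseChange ↥F).localPolynomialAt w : ℤ[X]) :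
        PowerSeries ℤ)) 1 = 1 ∧
      ∀ n, n ≠ 1 → n.Coprime m →
        (∏ᶠ w ∈ {w : HeightOneSpectrum (𝓞 ↥F) | w.under (𝓞 ℚ) = v},
          ofPowerSeries w.residueCard (((W.baseChange ↥F).localPolynomialAt w : ℤ[X]) :
            PowerSeries ℤ)) n = 0 by
    refine ⟨by rw [intCoe_apply, h.1, Int.cast_one], fun n hn hnm ↦ ?_⟩
    rw [intCoe_apply, h.2 n hn hnm, Int.cast_zero]
  refine finprod_mem_induction (fun B : ArithmeticFunction ℤ ↦
      B 1 = 1 ∧ ∀ n, n ≠ 1 → n.Coprime m → B n = 0)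
    ⟨one_apply, fun n hn _ ↦ one_apply_ne hn⟩
    (fun f g hf hg ↦ mul_apply_eq_zero_of_coprime m hf hg) fun w hw ↦ ?_
  exact ofPowerSeries_apply_eq_zero_of_coprime m w.one_lt_residueCard
    (not_coprime_residueCard_of_under_eq m K H hv hw) _
    (by rw [Polynomial.constantCoeff_coe, (W.baseChange ↥F).coeff_zero_localPolynomialAt w])

end Coefficients

/-! ## The terms at `p ≡ 1 (mod m)` -/

section PerPrime

variable (W : WeierstrassCurve ℚ) [W.IsElliptic] (m : ℕ) [NeZero m] (K : Type) [Field K]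
  [NumberField K] [IsCyclotomicExtension {m} ℚ K] [IsGalois ℚ K] [IsMulCommutative Gal(K/ℚ)]
  (H : Subgroup Gal(K/ℚ))

omit [W.IsElliptic] [NeZero m] [IsCyclotomicExtension {m} ℚ K] [IsGalois ℚ K]
  [IsMulCommutative Gal(K/ℚ)] in
/-- The twists `χ • L(E)` are normalised: `(χ • L(E))(1) = χ(1) a₁(E) = 1`. [folklore] -/
theorem twist_intCoe_LFunction_apply_one (χ : DirichletCharacter ℂ m) :
    (toArithmeticFunction (fun k : ℕ ↦ χ (k : ZMod m))).pmul
      ((W.LFunction : ArithmeticFunction ℤ) : ArithmeticFunction ℂ) 1 = 1 := by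
  rw [twist_apply, intCoe_apply, W.LFunction_apply_one, Nat.cast_one, map_one, Int.cast_one,
    mul_one]

omit [W.IsElliptic] [IsGalois ℚ K] [IsMulCommutative Gal(K/ℚ)] in
/-- **`c_p(E_F) = d · a_p(E)` at a prime `p ≡ 1 (mod m)`** (`d = #Y_H = [F : ℚ]`): such a prime is
coprime to `m`, every `χ ∈ Y_H` has `χ(p) = 1`, and a prime has no non-trivial factorisation
(`ArithmeticFunction.finsetProd_apply_prime`). [folklore] -/
theorem prod_twist_apply_prime {p : ℕ} (hp : p.Prime) (hpm : (p : ZMod m) = 1) :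
    (∏ χ ∈ Finset.univ.filter (fun χ : DirichletCharacter ℂ m ↦
          χ ∈ (subgroupGalEquivSubgroupChar m K ℂ H).ofDual),
        (toArithmeticFunction (fun k : ℕ ↦ χ (k : ZMod m))).pmul
          ((W.LFunction : ArithmeticFunction ℤ) : ArithmeticFunction ℂ)) p =
      ((Finset.univ.filter (fun χ : DirichletCharacter ℂ m ↦
          χ ∈ (subgroupGalEquivSubgroupChar m K ℂ H).ofDual)).card : ℂ) * (W.LFunction p : ℂ) := by
  rw [finsetProd_apply_prime _ _ (fun χ ↦ twist_intCoe_LFunction_apply_one W m χ) hp,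
    Finset.sum_congr rfl fun χ _ ↦ by rw [twist_apply, hpm, map_one, one_mul, intCoe_apply],
    Finset.sum_const, nsmul_eq_mul]

omit [IsGalois ℚ K] [IsMulCommutative Gal(K/ℚ)] in
/-- **`c_{p²}(E_F) = -d · p` at a prime `p ≡ 1 (mod m)` of good reduction with `a_p(E) = 0`**: every
twist vanishes at `p`, so only the values at `p²` contribute
(`finsetProd_apply_prime_sq_of_apply_prime_eq_zero`), `χ(p²) = 1`, and `a_{p²} = a_p² - p = -p`
(Diamond–Shurman (8.44), `WeierstrassCurve.LFunction_apply_prime_pow_add_two_of_prime`).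
[folklore] -/
theorem prod_twist_apply_prime_sq {p : ℕ} (hp : p.Prime) (hpm : (p : ZMod m) = 1)
    (hN : ¬ p ∣ W.conductorNorm ℤ) (h0 : W.LFunction p = 0) :
    (∏ χ ∈ Finset.univ.filter (fun χ : DirichletCharacter ℂ m ↦
          χ ∈ (subgroupGalEquivSubgroupChar m K ℂ H).ofDual),
        (toArithmeticFunction (fun k : ℕ ↦ χ (k : ZMod m))).pmul
          ((W.LFunction : ArithmeticFunction ℤ) : ArithmeticFunction ℂ)) (p ^ 2) =
      -(((Finset.univ.filter (fun χ : DirichletCharacter ℂ m ↦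
          χ ∈ (subgroupGalEquivSubgroupChar m K ℂ H).ofDual)).card : ℂ) * (p : ℂ)) := by
  have hp2 : W.LFunction (p ^ 2) = -(p : ℤ) := by
    have h := W.LFunction_apply_prime_pow_add_two_of_prime hp 0
    rw [zero_add, zero_add, pow_one, h0, zero_mul, zero_sub, if_neg hN, pow_zero,
      W.LFunction_apply_one, mul_one] at h
    exact h
  rw [finsetProd_apply_prime_sq_of_apply_prime_eq_zero _ _
      (fun χ ↦ twist_intCoe_LFunction_apply_one W m χ) hp
      (fun χ ↦ by rw [twist_apply, intCoe_apply, h0, Int.cast_zero, mul_zero]),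
    Finset.sum_congr rfl fun χ _ ↦ by
      rw [twist_apply, Nat.cast_pow, hpm, one_pow, map_one, one_mul, intCoe_apply, hp2],
    Finset.sum_const, nsmul_eq_mul, Int.cast_neg, Int.cast_natCast, mul_neg]

/-- **The terms of `∑ |cₙ(E_F)| n^{-σ}` at `n = p, p²` dominate `p^{-σ}`** for `σ ≤ 1` and a prime
`p ≡ 1 (mod m)` of good reduction: `a_p(E) ∈ ℤ`, so either `a_p = 0` and
`|c_{p²}| p^{-2σ} = d p^{1-2σ} ≥ p^{-σ}`, or `|c_p| p^{-σ} = d |a_p| p^{-σ} ≥ p^{-σ}`. [folklore] -/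
theorem rpow_neg_le_norm_apply_prime_add {p : ℕ} (hp : p.Prime) (hpm : (p : ZMod m) = 1)
    (hN : ¬ p ∣ W.conductorNorm ℤ) {σ : ℝ} (hσ : σ ≤ 1) :
    (p : ℝ) ^ (-σ) ≤
      ‖(((W.baseChange ↥(IntermediateField.fixedField H)).LFunction : ArithmeticFunction ℤ) :
          ArithmeticFunction ℂ) p‖ / (p : ℝ) ^ σ +
        ‖(((W.baseChange ↥(IntermediateField.fixedField H)).LFunction : ArithmeticFunction ℤ) :
          ArithmeticFunction ℂ) (p ^ 2)‖ / ((p ^ 2 : ℕ) : ℝ) ^ σ := by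
  set Y := Finset.univ.filter (fun χ : DirichletCharacter ℂ m ↦
    χ ∈ (subgroupGalEquivSubgroupChar m K ℂ H).ofDual) with hY
  have hcop : p.Coprime m := (ZMod.isUnit_iff_coprime p m).mp (hpm ▸ isUnit_one)
  rw [intCoe_LFunction_baseChange_fixedField_apply_of_coprime W m K H hcop,
    intCoe_LFunction_baseChange_fixedField_apply_of_coprime W m K H (hcop.pow_left 2)]
  have h1Y : (1 : DirichletCharacter ℂ m) ∈ Y := by
    rw [hY, Finset.mem_filter]
    exact ⟨Finset.mem_univ _, one_mem _⟩
  have hcard : (1 : ℝ) ≤ Y.card := by exact_mod_cast Finset.card_pos.mpr ⟨1, h1Y⟩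
  have hp0 : (0 : ℝ) < p := by exact_mod_cast hp.pos
  have hp1 : (1 : ℝ) ≤ p := by exact_mod_cast hp.one_lt.le
  rcases eq_or_ne (W.LFunction p) 0 with h0 | h0
  · -- `a_p = 0`: use the term at `p²`
    have h2 : ‖(∏ χ ∈ Y, (toArithmeticFunction (fun k : ℕ ↦ χ (k : ZMod m))).pmul
        ((W.LFunction : ArithmeticFunction ℤ) : ArithmeticFunction ℂ)) (p ^ 2)‖ =
        (Y.card : ℝ) * p := by
      rw [hY, prod_twist_apply_prime_sq W m K H hp hpm hN h0, norm_neg, norm_mul,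
        Complex.norm_natCast, Complex.norm_natCast]
    refine le_add_of_nonneg_of_le (by positivity) ?_
    rw [h2]
    calc (p : ℝ) ^ (-σ) ≤ (p : ℝ) ^ (1 - 2 * σ) :=
          Real.rpow_le_rpow_of_exponent_le hp1 (by linarith)
      _ = (p : ℝ) / ((p ^ 2 : ℕ) : ℝ) ^ σ := by
          rw [Nat.cast_pow, ← Real.rpow_natCast (p : ℝ) 2, ← Real.rpow_mul hp0.le,
            Real.rpow_sub hp0, Real.rpow_one, Nat.cast_ofNat]
      _ ≤ (Y.card : ℝ) * p / ((p ^ 2 : ℕ) : ℝ) ^ σ := by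
          gcongr
          exact le_mul_of_one_le_left hp0.le hcard
  · -- `a_p ≠ 0`: use the term at `p`
    have h1 : (1 : ℝ) ≤ ‖(∏ χ ∈ Y, (toArithmeticFunction (fun k : ℕ ↦ χ (k : ZMod m))).pmul
        ((W.LFunction : ArithmeticFunction ℤ) : ArithmeticFunction ℂ)) p‖ := by
      rw [hY, prod_twist_apply_prime W m K H hp hpm, norm_mul, Complex.norm_natCast,
        Complex.norm_intCast]
      exact one_le_mul_of_one_le_of_one_le hcard (by exact_mod_cast Int.one_le_abs h0)
    refine le_add_of_le_of_nonneg ?_ (by positivity)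
    calc (p : ℝ) ^ (-σ) = 1 / (p : ℝ) ^ σ := by rw [Real.rpow_neg hp0.le, one_div]
      _ ≤ _ := by gcongr

end PerPrime

end Summit.BirchSwinnertonDyer.BirchSwinnertonDyer.Theorems

end
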